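import Mathlib
import Literature.Analysis.FluidPDE.Tao2016AveragedNS.BoundedEternalSolutions
import Summits.NavierStokesRegularity.NavierStokesRegularity.Theorems.WakeRatchetEternalViscousRateCircuitPumpEveryScale
import Summits.NavierStokesRegularity.NavierStokesRegularity.Theorems.TaoLadderRungTwoBreakNoLoudLadderOne.Negative.NoLoudLadderOneFalseOfViscousBlockDSSWaves
import HarnessLib

/-!
# Crux K1ᵛ(1) `TaoLadderRungTwoBreak.NoSurvivingEternalViscBddOne` (stmt-NavierStokesRegularity-20419) and its split child (ρ+)
# `NoLoudLadderOne` (stmt-NavierStokesRegularity-20452): SURVIVING LOUD PUMPS AT EVERY FINE SCALE — the hypothesis classes are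
# populated by non-zero, bounded, loud, (S₁)-surviving members at every fine scale ratio (UNCONDITIONAL; consequences in `…Threshold`)

MODEL lattice ODEs only (Tao 2016 §4, log-time variables §6.4; cell vocabulary `IsEternalVisc`, `UniformBound`,
`EternalSurvivingFwd`, `wtEnergy`, `NoSurvivingEternalViscBdd`, `NoLoudLadder`); nothing in this file is a statement about the
Navier–Stokes equations; no stub, crux or summit is closed (`--supports stmt-NavierStokesRegularity-20419`).

THE POINT.  The item text of ⟨20419⟩ carries the caveat D-12 «the only exhibited member of the hypothesis class is `W = 0`», and the
`why it might fail` of (ρ+) ⟨20452⟩ calls the bridge «Toda DSS pump ⟹ bounded loud ladder» UNTYPED.  Both are settled here, at the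
pump's own spread, by composing LANDED bricks of route WakeRatchet's `…CircuitPump*` chain (pump at every prescribed scale
`todaPump_at`, padding `…CircuitPumpPad/PadClass`, class `todaTable_inTableClass`, renormalisation `viscousBlockDSS_of_pumpWitness`,
action `action_of_typeI`, boundedness `shellBound_of_typeI`) with the block-orbit survival lemma `survivingFwd_of_viscBlockDSS`
(`…NoLoudLadderOne/Negative/…ViscousBlockDSSWaves`) and the tree's PROVED seeded slice `noSurvivingViscSeededBdd R 4096`:

* `survivingFwd_of_pumpWitness` — ANY period-1 exactly self-similar Type-I non-trivial solution of an `m = 4` viscous circuit at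
  scale parameter `lam > 1` renormalises, at `ε₀ = lam^{2/5} − 1`, to an admissible eternal solution with covariant viscosity `ν̂ = 1`
  of the pulled-back table that is UNIFORMLY BOUNDED, block-self-similar with the pinned lag `2 log(1+ε₀)`, NON-TRIVIAL and
  **forward (S₁)-SURVIVING** (no cancellation hypothesis is needed for survival: the a=1 weight `(1+ε₀)^{-4}` per shell is exactly
  compensated by the lag along the block orbit of a non-zero point);
* `survivingLoudPump_at_scale` — **for EVERY `ε₀ > 0` with `(1+ε₀)^{5/2} ≤ 3/2` (`ε₀ ≤ (3/2)^{2/5} − 1 ≈ 0.176`) there are a spread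
  `R ≥ 1`, a table `α ∈ E₂(R)` (the seeded Toda member `T_ε` padded to `Fin 4`, `R = 2/ε`, `ε = ε(ε₀) ≤ 10⁻⁵`) and `W` with
  `IsEternalVisc ε₀ 1 α W ∧ UniformBound W ∧ EternalSurvivingFwd 1 ε₀ W`, `W ≢ 0`, which is moreover LOUD ON EVERY SHELL**
  (`∀ n₀ s₀, s₀ < 1/4096 → ∃ σ, s₀ < wtEnergy ε₀ W n₀ σ` — forced by the seeded slice: a survivor can have no seed);
* the consequences (inner blocks false at every fine scale, NO SPREAD-UNIFORM THRESHOLD, threshold forced below every fine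
  scale, and the same BY NAME under the cruxes) are in the sequel `…SurvivingPumpsThreshold`.

READING for ⟨20419⟩/⟨20452⟩ (census of this hand): the D-12 caveat is lifted for the VISCOUS hypothesis classes (nonzero, bounded,
loud, surviving members exist at every fine scale on spread-dependent tables); it stands for the INVISCID child (ρ0) ⟨20451⟩, whose
only candidate members are the unconstructed blow-up profiles (D-12, `GlobalSelfSimilarProfiles`).  What remains open is exactly the
fixed-spread statement (`FineFixedSeedTodaPumps` on the ¬ side; the W1 Kolmogorov-wake programme on the proof side).
HONEST LABEL: composition of landed theorems; ⟨20419⟩, (ρ0), (ρ+) and every NS statement remain OPEN; rung 0.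
-/

noncomputable section

-- the summit and its single sub-problem share the name (CONVENTIONS §1)
set_option linter.dupNamespace false

namespace Summit.NavierStokesRegularity.NavierStokesRegularity.Theorems.NoSurvivingEternalViscBddOne.SurvivingPumps

open Set Filter Topology MeasureTheory
open Literature.Analysis.FluidPDE Literature.Analysis.FluidPDE.TaoCascade
open Summit.NavierStokesRegularity.NavierStokesRegularity.Theorems.CircuitPumpNegative
open Summit.NavierStokesRegularity.NavierStokesRegularity.Theorems.PerpetualPumpCircuitPump
open Summit.NavierStokesRegularity.NavierStokesRegularity.Theorems.WakeRatchetCircuitPumpBdd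
open Summit.NavierStokesRegularity.NavierStokesRegularity.Theorems.WakeRatchetCircuitPumpAssembly
open Summit.NavierStokesRegularity.NavierStokesRegularity.Theorems.WakeRatchetCircuitPumpAction
open Summit.NavierStokesRegularity.NavierStokesRegularity.Theorems.WakeRatchetCircuitPumpPad
open Summit.NavierStokesRegularity.NavierStokesRegularity.Theorems.WakeRatchetCircuitPumpPadClass
open Summit.NavierStokesRegularity.NavierStokesRegularity.Theorems.WakeRatchetCircuitPumpTodaClass
open Summit.NavierStokesRegularity.NavierStokesRegularity.Theorems.WakeRatchetCircuitPumpNoUniform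
  (toda_pullback_eq norm_shellVec_pad)
open Summit.NavierStokesRegularity.NavierStokesRegularity.Cruxes.EternalViscousRate.DissipationEdge
  (survivingFwd_of_viscBlockDSS)

/-! ## Any period-1 pump witness renormalises to a SURVIVING bounded admissible viscous eternal solution -/

/-- **Survival of the renormalised pump** (general `m = 4` circuit, any scale parameter `lam > 1`): a period-1 exactly
self-similar, Type-I, non-trivial solution `X` of `SolvesODE lam coeff X` on `t < 0` yields, at `ε₀ = lam^{2/5} − 1`
(`(1+ε₀)^{5/2} = lam`), a `W : ℤ → ℝ → ℝ⁴` with `IsEternalVisc ε₀ 1 (pulled-back coeff) W`, `UniformBound W`, the block-DSS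
relation `W_{n+1}(σ) = W_n(σ − 2 log(1+ε₀))`, a non-zero point, and `EternalSurvivingFwd 1 ε₀ W`.  The action and the
boundedness near the blow-up time are discharged by `action_of_typeI` / `shellBound_of_typeI`; survival by
`survivingFwd_of_viscBlockDSS` with period `p = 1` (no cancellation hypothesis needed).  MODEL lattice only.
[cite: Tao2016AveragedNS, §4 Thm. 4.2 (statement shape), the viscous equation before it, §6.4; cell vocabulary (stmt-NavierStokesRegularity-20419)] -/
theorem survivingFwd_of_pumpWitness {lam : ℝ} (hlam : 1 < lam)
    (coeff : Fin 4 → Fin 4 → Fin 4 → Option (Fin 3) → ℝ) (X : Fin 4 → ℤ → ℝ → ℝ)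
    (hode : SolvesODE lam coeff X) (hdss : IsDSS lam 1 X) (hTI : IsTypeI lam X) (hnt : IsNontrivial X) :
    ∃ (ε₀ : ℝ) (W : ℤ → ℝ → Em 4), 0 < ε₀ ∧ (1 + ε₀) ^ ((5 : ℝ) / 2) = lam ∧
      IsEternalVisc ε₀ 1 (fun (i₁ i₂ i₃ : Fin 4) (μ : ℤ × ℤ × ℤ) =>
        if μ = (0, 0, 0) then coeff i₁ i₂ i₃ none
        else if μ = (1, 0, 0) then coeff i₁ i₂ i₃ (some 0)
        else if μ = (0, 1, 0) then coeff i₁ i₂ i₃ (some 1)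
        else if μ = (0, 0, 1) then coeff i₁ i₂ i₃ (some 2) else 0) W ∧
      UniformBound W ∧
      (∀ (n : ℤ) (σ : ℝ), W (n + 1) σ = W n (σ - 2 * Real.log (1 + ε₀))) ∧
      (∃ (n : ℤ) (σ : ℝ), W n σ ≠ 0) ∧
      EternalSurvivingFwd 1 ε₀ W := by
  obtain ⟨M, hact⟩ := action_of_typeI hlam coeff X hode hTI
  have hbd := shellBound_of_typeI hlam coeff X hode hTI
  obtain ⟨ε₀, W, hε, hlamε, hW, hU, hD, hne⟩ :=
    viscousBlockDSS_of_pumpWitness hlam coeff X hode hdss hTI hnt hact hbd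
  refine ⟨ε₀, W, hε, hlamε, hW, hU, hD, hne, ?_⟩
  obtain ⟨n₀, σ₀, hne₀⟩ := hne
  have hD' : ∀ (n : ℤ) (σ : ℝ), W (n + (1 : ℕ)) σ = W n (σ - 2 * Real.log (1 + ε₀)) := by
    intro n σ
    simpa using hD n σ
  exact survivingFwd_of_viscBlockDSS hε one_pos hW one_pos hD' hne₀

/-! ## A quadratic ceiling recursion with a sub-unit seed decays below every level -/

/-- If `0 ≤ S n`, `S (n+1) ≤ L · S(n)²` for `n ≥ n₀` and `L · S(n₀) < 1`, then `S n` is eventually below every positive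
level (`L · S(n₀+k) ≤ (L · S n₀)^{k+1}`).  Public twin of the private decay step behind the tree's seeded slice
`noSurvivingViscSeededBdd`, needed here at a PRESCRIBED scale ratio (the packaged slice hides its threshold).
[folklore] -/
theorem ceilings_eventually_lt {S : ℕ → ℝ} {L : ℝ} {n₀ : ℕ} (hL : 0 < L)
    (hS0 : ∀ n, n₀ ≤ n → 0 ≤ S n) (hrec : ∀ n, n₀ ≤ n → S (n + 1) ≤ L * S n ^ 2)
    (hseed : L * S n₀ < 1) (c : ℝ) (hc : 0 < c) : ∃ N : ℕ, ∀ n, N ≤ n → S n < c := by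
  have hq0 : 0 ≤ L * S n₀ := mul_nonneg hL.le (hS0 n₀ le_rfl)
  have hbound : ∀ k : ℕ, L * S (n₀ + k) ≤ (L * S n₀) ^ (k + 1) := by
    intro k
    induction k with
    | zero => simp
    | succ k ih =>
      have hk0 : 0 ≤ L * S (n₀ + k) := mul_nonneg hL.le (hS0 _ (Nat.le_add_right _ _))
      calc L * S (n₀ + (k + 1)) = L * S (n₀ + k + 1) := by rw [Nat.add_assoc]
        _ ≤ L * (L * S (n₀ + k) ^ 2) :=
            mul_le_mul_of_nonneg_left (hrec _ (Nat.le_add_right _ _)) hL.le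
        _ = (L * S (n₀ + k)) ^ 2 := by ring
        _ ≤ ((L * S n₀) ^ (k + 1)) ^ 2 := pow_le_pow_left₀ hk0 ih 2
        _ = (L * S n₀) ^ (k + 1) * (L * S n₀) ^ (k + 1) := sq _
        _ ≤ (L * S n₀) ^ (k + 1) * (L * S n₀) ^ 1 :=
            mul_le_mul_of_nonneg_left (pow_le_pow_of_le_one hq0 hseed.le (by omega)) (pow_nonneg hq0 _)
        _ = (L * S n₀) ^ (k + 1 + 1) := by ring
  have ht : Tendsto (fun k : ℕ => (L * S n₀) ^ (k + 1)) atTop (𝓝 0) :=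
    (tendsto_pow_atTop_nhds_zero_of_lt_one hq0 hseed).comp (tendsto_add_atTop_nat 1)
  obtain ⟨K, hK⟩ := (ht.eventually (gt_mem_nhds (mul_pos hL hc))).exists_forall_of_atTop
  refine ⟨n₀ + K, fun n hn => ?_⟩
  obtain ⟨k, rfl⟩ : ∃ k, n = n₀ + k := ⟨n - n₀, by omega⟩
  have h1 : L * S (n₀ + k) < L * c := (hbound k).trans_lt (hK k (by omega))
  exact lt_of_mul_lt_mul_left h1 hL.le

/-! ## At every fine scale: a surviving, loud, bounded admissible pump on a comparable table -/

/-- **Surviving loud pumps at EVERY fine scale.**  For every `ε₀ > 0` with `(1+ε₀)^{5/2} ≤ 3/2` there are `R ≥ 1`, a table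
`α ∈ E₂(R)` (the padded seeded Toda member, `R = 2/ε`) and `W` with `IsEternalVisc ε₀ 1 α W`, `UniformBound W`,
`EternalSurvivingFwd 1 ε₀ W`, the block-DSS relation with lag `2 log(1+ε₀)`, a non-zero point, and LOUDNESS ON EVERY SHELL at the
dissipation-critical level `ν̂²/4096 = 1/4096` (by the proved seeded slice `noSurvivingViscSeededBdd R 4096`: a seed would kill the
survivor).  MODEL lattice only.
[cite: Tao2016AveragedNS, §4 Thm. 4.2 (statement shape), the viscous equation before it, §6.4; cell vocabulary (stmt-NavierStokesRegularity-20419, stmt-NavierStokesRegularity-20452)] -/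
theorem survivingLoudPump_at_scale (ε₀ : ℝ) (hε₀ : 0 < ε₀) (hε₀le : (1 + ε₀) ^ ((5 : ℝ) / 2) ≤ 3 / 2) :
    ∃ R : ℝ, 1 ≤ R ∧ ∃ α : Fin 4 → Fin 4 → Fin 4 → ℤ × ℤ × ℤ → ℝ, InTableClass R α ∧
      ∃ W : ℤ → ℝ → Em 4, IsEternalVisc ε₀ 1 α W ∧ UniformBound W ∧ EternalSurvivingFwd 1 ε₀ W ∧
        (∀ (n : ℤ) (σ : ℝ), W (n + 1) σ = W n (σ - 2 * Real.log (1 + ε₀))) ∧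
        (∃ (n : ℤ) (σ : ℝ), W n σ ≠ 0) ∧
        (∀ (n₀ : ℕ) (s₀ : ℝ), s₀ < 1 / 4096 → ∃ σ : ℝ, s₀ < wtEnergy ε₀ W n₀ σ) := by
  have hlam : (1 : ℝ) < (1 + ε₀) ^ ((5 : ℝ) / 2) := Real.one_lt_rpow (by linarith) (by norm_num)
  obtain ⟨ε, hε, hε5, X, hode, hdss, hTI, hnt⟩ := todaPump_at _ hlam hε₀le
  generalize hlamdef : (1 + ε₀) ^ ((5 : ℝ) / 2) = lam at hlam hode hdss hTI
  -- pad to four modes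
  have hode₄ := solvesODE_pad (k := 2) hode
  have hdss₄ := isDSS_pad (k := 2) hdss
  have hTI₄ := isTypeI_pad (k := 2) hlam hTI
  have hnt₄ := isNontrivial_pad (k := 2) hnt
  -- the padded pulled-back table is the padding of the m = 2 Toda member of `E₂(2/ε)`
  have hε1 : ε ≤ 1 := by linarith
  have h2 : InTableClass (2 / ε) (fun (i₁ i₂ i₃ : Fin 2) (μ : ℤ × ℤ × ℤ) =>
            if μ = (0, 0, 0) then (fun (i₁ i₂ i₃ : Fin 2) (μ : Option (Fin 3)) => if μ = none then (if i₁ = 1 ∧ i₂ = 1 ∧ i₃ = 0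
              then (-1 : ℝ) else if i₁ = 1 ∧ i₂ = 0 ∧ i₃ = 1 then 1 / 2 else if i₁ = 0 ∧ i₂ = 1 ∧ i₃ = 1
              then 1 / 2 else if i₁ = 0 ∧ i₂ = 0 ∧ i₃ = 1 then ε else if i₁ = 0 ∧ i₂ = 1 ∧ i₃ = 0 then -ε /
              2 else if i₁ = 1 ∧ i₂ = 0 ∧ i₃ = 0 then -ε / 2 else 0) else if μ = some 2 then (if i₁ = 1 ∧
              i₂ = 1 ∧ i₃ = 0 then 1 else 0) else if μ = some 1 then (if i₁ = 1 ∧ i₂ = 0 ∧ i₃ = 1 then -1 /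
              2 else 0) else (if i₁ = 0 ∧ i₂ = 1 ∧ i₃ = 1 then -1 / 2 else 0)) i₁ i₂ i₃ none
            else if μ = (1, 0, 0) then (fun (i₁ i₂ i₃ : Fin 2) (μ : Option (Fin 3)) => if μ = none then (if i₁ = 1 ∧ i₂ = 1 ∧ i₃ = 0
              then (-1 : ℝ) else if i₁ = 1 ∧ i₂ = 0 ∧ i₃ = 1 then 1 / 2 else if i₁ = 0 ∧ i₂ = 1 ∧ i₃ = 1
              then 1 / 2 else if i₁ = 0 ∧ i₂ = 0 ∧ i₃ = 1 then ε else if i₁ = 0 ∧ i₂ = 1 ∧ i₃ = 0 then -ε /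
              2 else if i₁ = 1 ∧ i₂ = 0 ∧ i₃ = 0 then -ε / 2 else 0) else if μ = some 2 then (if i₁ = 1 ∧
              i₂ = 1 ∧ i₃ = 0 then 1 else 0) else if μ = some 1 then (if i₁ = 1 ∧ i₂ = 0 ∧ i₃ = 1 then -1 /
              2 else 0) else (if i₁ = 0 ∧ i₂ = 1 ∧ i₃ = 1 then -1 / 2 else 0)) i₁ i₂ i₃ (some 0)
            else if μ = (0, 1, 0) then (fun (i₁ i₂ i₃ : Fin 2) (μ : Option (Fin 3)) => if μ = none then (if i₁ = 1 ∧ i₂ = 1 ∧ i₃ = 0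
              then (-1 : ℝ) else if i₁ = 1 ∧ i₂ = 0 ∧ i₃ = 1 then 1 / 2 else if i₁ = 0 ∧ i₂ = 1 ∧ i₃ = 1
              then 1 / 2 else if i₁ = 0 ∧ i₂ = 0 ∧ i₃ = 1 then ε else if i₁ = 0 ∧ i₂ = 1 ∧ i₃ = 0 then -ε /
              2 else if i₁ = 1 ∧ i₂ = 0 ∧ i₃ = 0 then -ε / 2 else 0) else if μ = some 2 then (if i₁ = 1 ∧
              i₂ = 1 ∧ i₃ = 0 then 1 else 0) else if μ = some 1 then (if i₁ = 1 ∧ i₂ = 0 ∧ i₃ = 1 then -1 /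
              2 else 0) else (if i₁ = 0 ∧ i₂ = 1 ∧ i₃ = 1 then -1 / 2 else 0)) i₁ i₂ i₃ (some 1)
            else if μ = (0, 0, 1) then (fun (i₁ i₂ i₃ : Fin 2) (μ : Option (Fin 3)) => if μ = none then (if i₁ = 1 ∧ i₂ = 1 ∧ i₃ = 0
              then (-1 : ℝ) else if i₁ = 1 ∧ i₂ = 0 ∧ i₃ = 1 then 1 / 2 else if i₁ = 0 ∧ i₂ = 1 ∧ i₃ = 1
              then 1 / 2 else if i₁ = 0 ∧ i₂ = 0 ∧ i₃ = 1 then ε else if i₁ = 0 ∧ i₂ = 1 ∧ i₃ = 0 then -ε /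
              2 else if i₁ = 1 ∧ i₂ = 0 ∧ i₃ = 0 then -ε / 2 else 0) else if μ = some 2 then (if i₁ = 1 ∧
              i₂ = 1 ∧ i₃ = 0 then 1 else 0) else if μ = some 1 then (if i₁ = 1 ∧ i₂ = 0 ∧ i₃ = 1 then -1 /
              2 else 0) else (if i₁ = 0 ∧ i₂ = 1 ∧ i₃ = 1 then -1 / 2 else 0)) i₁ i₂ i₃ (some 2) else 0) := by
    rw [toda_pullback_eq ε]
    exact todaTable_inTableClass ε hε hε1
  have hclass : InTableClass (2 / ε) (fun (j₁ j₂ j₃ : Fin (2 + 2)) (μ : ℤ × ℤ × ℤ) =>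
            if μ = (0, 0, 0) then (Fin.append (fun i₁ : Fin 2 => Fin.append (fun i₂ : Fin 2 => Fin.append ((fun (i₁ i₂ i₃ : Fin 2) (μ : Option (Fin 3)) => if μ = none then (if i₁ = 1 ∧ i₂ = 1 ∧ i₃ = 0
              then (-1 : ℝ) else if i₁ = 1 ∧ i₂ = 0 ∧ i₃ = 1 then 1 / 2 else if i₁ = 0 ∧ i₂ = 1 ∧ i₃ = 1
              then 1 / 2 else if i₁ = 0 ∧ i₂ = 0 ∧ i₃ = 1 then ε else if i₁ = 0 ∧ i₂ = 1 ∧ i₃ = 0 then -ε /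
              2 else if i₁ = 1 ∧ i₂ = 0 ∧ i₃ = 0 then -ε / 2 else 0) else if μ = some 2 then (if i₁ = 1 ∧
              i₂ = 1 ∧ i₃ = 0 then 1 else 0) else if μ = some 1 then (if i₁ = 1 ∧ i₂ = 0 ∧ i₃ = 1 then -1 /
              2 else 0) else (if i₁ = 0 ∧ i₂ = 1 ∧ i₃ = 1 then -1 / 2 else 0)) i₁ i₂)
              (fun (_ : Fin 2) (_ : Option (Fin 3)) => (0 : ℝ)))
            (fun (_ : Fin 2) (_ : Fin (2 + 2)) (_ : Option (Fin 3)) => (0 : ℝ)))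
            (fun (_ : Fin 2) (_ : Fin (2 + 2)) (_ : Fin (2 + 2)) (_ : Option (Fin 3)) => (0 : ℝ))) j₁ j₂ j₃ none
            else if μ = (1, 0, 0) then (Fin.append (fun i₁ : Fin 2 => Fin.append (fun i₂ : Fin 2 => Fin.append ((fun (i₁ i₂ i₃ : Fin 2) (μ : Option (Fin 3)) => if μ = none then (if i₁ = 1 ∧ i₂ = 1 ∧ i₃ = 0
              then (-1 : ℝ) else if i₁ = 1 ∧ i₂ = 0 ∧ i₃ = 1 then 1 / 2 else if i₁ = 0 ∧ i₂ = 1 ∧ i₃ = 1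
              then 1 / 2 else if i₁ = 0 ∧ i₂ = 0 ∧ i₃ = 1 then ε else if i₁ = 0 ∧ i₂ = 1 ∧ i₃ = 0 then -ε /
              2 else if i₁ = 1 ∧ i₂ = 0 ∧ i₃ = 0 then -ε / 2 else 0) else if μ = some 2 then (if i₁ = 1 ∧
              i₂ = 1 ∧ i₃ = 0 then 1 else 0) else if μ = some 1 then (if i₁ = 1 ∧ i₂ = 0 ∧ i₃ = 1 then -1 /
              2 else 0) else (if i₁ = 0 ∧ i₂ = 1 ∧ i₃ = 1 then -1 / 2 else 0)) i₁ i₂)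
              (fun (_ : Fin 2) (_ : Option (Fin 3)) => (0 : ℝ)))
            (fun (_ : Fin 2) (_ : Fin (2 + 2)) (_ : Option (Fin 3)) => (0 : ℝ)))
            (fun (_ : Fin 2) (_ : Fin (2 + 2)) (_ : Fin (2 + 2)) (_ : Option (Fin 3)) => (0 : ℝ))) j₁ j₂ j₃ (some 0)
            else if μ = (0, 1, 0) then (Fin.append (fun i₁ : Fin 2 => Fin.append (fun i₂ : Fin 2 => Fin.append ((fun (i₁ i₂ i₃ : Fin 2) (μ : Option (Fin 3)) => if μ = none then (if i₁ = 1 ∧ i₂ = 1 ∧ i₃ = 0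
              then (-1 : ℝ) else if i₁ = 1 ∧ i₂ = 0 ∧ i₃ = 1 then 1 / 2 else if i₁ = 0 ∧ i₂ = 1 ∧ i₃ = 1
              then 1 / 2 else if i₁ = 0 ∧ i₂ = 0 ∧ i₃ = 1 then ε else if i₁ = 0 ∧ i₂ = 1 ∧ i₃ = 0 then -ε /
              2 else if i₁ = 1 ∧ i₂ = 0 ∧ i₃ = 0 then -ε / 2 else 0) else if μ = some 2 then (if i₁ = 1 ∧
              i₂ = 1 ∧ i₃ = 0 then 1 else 0) else if μ = some 1 then (if i₁ = 1 ∧ i₂ = 0 ∧ i₃ = 1 then -1 /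
              2 else 0) else (if i₁ = 0 ∧ i₂ = 1 ∧ i₃ = 1 then -1 / 2 else 0)) i₁ i₂)
              (fun (_ : Fin 2) (_ : Option (Fin 3)) => (0 : ℝ)))
            (fun (_ : Fin 2) (_ : Fin (2 + 2)) (_ : Option (Fin 3)) => (0 : ℝ)))
            (fun (_ : Fin 2) (_ : Fin (2 + 2)) (_ : Fin (2 + 2)) (_ : Option (Fin 3)) => (0 : ℝ))) j₁ j₂ j₃ (some 1)
            else if μ = (0, 0, 1) then (Fin.append (fun i₁ : Fin 2 => Fin.append (fun i₂ : Fin 2 => Fin.append ((fun (i₁ i₂ i₃ : Fin 2) (μ : Option (Fin 3)) => if μ = none then (if i₁ = 1 ∧ i₂ = 1 ∧ i₃ = 0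
              then (-1 : ℝ) else if i₁ = 1 ∧ i₂ = 0 ∧ i₃ = 1 then 1 / 2 else if i₁ = 0 ∧ i₂ = 1 ∧ i₃ = 1
              then 1 / 2 else if i₁ = 0 ∧ i₂ = 0 ∧ i₃ = 1 then ε else if i₁ = 0 ∧ i₂ = 1 ∧ i₃ = 0 then -ε /
              2 else if i₁ = 1 ∧ i₂ = 0 ∧ i₃ = 0 then -ε / 2 else 0) else if μ = some 2 then (if i₁ = 1 ∧
              i₂ = 1 ∧ i₃ = 0 then 1 else 0) else if μ = some 1 then (if i₁ = 1 ∧ i₂ = 0 ∧ i₃ = 1 then -1 /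
              2 else 0) else (if i₁ = 0 ∧ i₂ = 1 ∧ i₃ = 1 then -1 / 2 else 0)) i₁ i₂)
              (fun (_ : Fin 2) (_ : Option (Fin 3)) => (0 : ℝ)))
            (fun (_ : Fin 2) (_ : Fin (2 + 2)) (_ : Option (Fin 3)) => (0 : ℝ)))
            (fun (_ : Fin 2) (_ : Fin (2 + 2)) (_ : Fin (2 + 2)) (_ : Option (Fin 3)) => (0 : ℝ))) j₁ j₂ j₃ (some 2) else 0) := by
    rw [pullback_pad_comm]
    exact inTableClass_pad (k := 2) h2
  -- renormalise the padded pump: bounded, block-DSS, non-trivial, SURVIVING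
  obtain ⟨ε₁, W, hε₁, hlamε, hW, hUB, hD, hne, hS⟩ :=
    survivingFwd_of_pumpWitness hlam _ _ hode₄ hdss₄ hTI₄ hnt₄
  -- the renormalised scale ratio of the witness is the prescribed one
  have h10 : (0 : ℝ) ≤ 1 + ε₀ := by linarith
  have h11 : (0 : ℝ) ≤ 1 + ε₁ := by linarith
  have h52 : (0 : ℝ) < (5 : ℝ) / 2 := by norm_num
  have hpow : (1 + ε₁) ^ ((5 : ℝ) / 2) = (1 + ε₀) ^ ((5 : ℝ) / 2) := by rw [hlamε, hlamdef]
  have heq : ε₁ = ε₀ := by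
    have hA := (Real.rpow_le_rpow_iff h11 h10 h52).1 hpow.le
    have hB := (Real.rpow_le_rpow_iff h10 h11 h52).1 hpow.ge
    linarith
  rw [heq] at hW hD hS
  have hR : (1 : ℝ) ≤ 2 / ε := by
    rw [le_div_iff₀ hε]; linarith
  -- loudness on every shell: a seed anywhere would kill the survivor ((τ′) at spread `2/ε`, threshold `ε₀` itself)
  have hloud : ∀ (n₀ : ℕ) (s₀ : ℝ), s₀ < 1 / 4096 → ∃ σ : ℝ, s₀ < wtEnergy ε₀ W n₀ σ := by
    intro n₀ s₀ hs₀
    by_contra hno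
    push Not at hno
    obtain ⟨S, hSc, hS0, hrec, hsd⟩ := tailRecursionAt_4096 (2 / ε) ε₀ ε₀ hε₀ le_rfl _ hclass 1 W one_pos hW n₀
      (typeIBound_of_uniformBound hUB n₀) ⟨s₀, by simpa using hs₀, hno⟩
    exact not_surviving_of_ceilings hSc (ceilings_eventually_lt (by norm_num) hS0 hrec hsd) hS
  exact ⟨2 / ε, hR, _, hclass, W, hW, hUB, hS, hD, hne, hloud⟩

/-! ## Appended (same hand): the pump obstruction is EXACTLY CRITICAL — no (S_a)-survival for `a < 1`

Along the block orbit the a-weighted energy of shell `n` is `θⁿ` times that of shell `0`, `θ = physWeight(a)·e^{2T} = (1+ε₀)^{a−1}`;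
for `a < 1`, `θ < 1` and the bounded shell-`0` energy cannot sustain any level.  So the surviving pumps kill spread-uniform
thresholds of the Liouville predicates at exponent `a = 1` (and, by `EternalSurvivingFwd.mono`, `a ≥ 1`) but say NOTHING at `a < 1`
(recorded for the planners: `NoSurvivingEternalViscBdd R a`, `a < 1`, is weaker than K1ᵛ(1) — tree `noSurvivingEternalViscBdd_of_le` —
and is not attacked by this witness family).  MODEL lattice only. -/

/-- **A uniformly bounded block-DSS family with the pinned lag `2 log(1+ε₀)` is NOT (S_a)-surviving for any `a < 1`**
(shell `0` renormalised energy bounded on a right half-line — the `bdd` clause — suffices).  MODEL lattice only.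
[cite: Tao2016AveragedNS, §4 Thm. 4.2 (statement shape), the viscous equation before it, §6.4; cell vocabulary (stmt-NavierStokesRegularity-20419)] -/
theorem not_survivingFwd_of_blockDSS_lt_one {ε₀ : ℝ} {W : ℤ → ℝ → Em 4} (hε : 0 < ε₀)
    (hU : UniformBound W) (hbdd : ∃ σ₀ P : ℝ, ∀ σ, σ₀ ≤ σ → Real.exp (2 * σ) * ‖W 0 σ‖ ^ 2 ≤ P)
    (hD : ∀ (n : ℤ) (σ : ℝ), W (n + 1) σ = W n (σ - 2 * Real.log (1 + ε₀)))
    {a : ℝ} (ha : a < 1) : ¬ EternalSurvivingFwd a ε₀ W := by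
  have hb : (0 : ℝ) < 1 + ε₀ := by linarith
  have hb1 : (1 : ℝ) < 1 + ε₀ := by linarith
  set T : ℝ := 2 * Real.log (1 + ε₀) with hT
  -- the block orbit back to shell `0`
  have horbit : ∀ (n : ℕ) (σ : ℝ), W (n : ℤ) σ = W 0 (σ - n * T) := by
    intro n
    induction n with
    | zero => intro σ; simp
    | succ k ih =>
      intro σ
      have h1 : ((k + 1 : ℕ) : ℤ) = (k : ℤ) + 1 := by push_cast; ring
      rw [h1, hD, ih]
      congr 1
      push_cast
      ring
  -- a global bound on the renormalised energy of shell `0`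
  obtain ⟨B, hB⟩ := hU
  obtain ⟨σ₀, P, hP⟩ := hbdd
  set P' : ℝ := max P (Real.exp (2 * σ₀) * B ^ 2) with hP'
  have hE0 : ∀ s : ℝ, Real.exp (2 * s) * ‖W 0 s‖ ^ 2 ≤ P' := by
    intro s
    by_cases hs : σ₀ ≤ s
    · exact (hP s hs).trans (le_max_left _ _)
    · push Not at hs
      have h1 : Real.exp (2 * s) ≤ Real.exp (2 * σ₀) := Real.exp_le_exp.2 (by linarith)
      have h2 : ‖W 0 s‖ ^ 2 ≤ B ^ 2 := pow_le_pow_left₀ (norm_nonneg _) (hB 0 s) 2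
      calc Real.exp (2 * s) * ‖W 0 s‖ ^ 2 ≤ Real.exp (2 * σ₀) * B ^ 2 :=
            mul_le_mul h1 h2 (by positivity) (by positivity)
        _ ≤ P' := le_max_right _ _
  -- the contraction ratio `θ = physWeight(a) · e^{2T} = (1+ε₀)^{a-1} < 1`
  have hexpT : Real.exp (2 * T) = (1 + ε₀) ^ (4 : ℕ) := by
    rw [hT, show 2 * (2 * Real.log (1 + ε₀)) = ((4 : ℕ) : ℝ) * Real.log (1 + ε₀) by push_cast; ring,
      Real.exp_nat_mul, Real.exp_log hb]
  set θ : ℝ := physWeight a ε₀ * Real.exp (2 * T) with hθ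
  have hθ0 : 0 ≤ θ := mul_nonneg (physWeight_nonneg hε.le) (Real.exp_pos _).le
  have hθ1 : θ < 1 := by
    rw [hθ, hexpT]
    unfold physWeight
    have h1 : (1 + ε₀) ^ a < (1 + ε₀) ^ (1 : ℝ) := Real.rpow_lt_rpow_of_exponent_lt hb1 ha
    rw [Real.rpow_one] at h1
    have h5 : (0 : ℝ) < (1 + ε₀) ^ 5 := by positivity
    rw [div_mul_eq_mul_div, div_lt_one h5]
    calc (1 + ε₀) ^ a * (1 + ε₀) ^ 4 < (1 + ε₀) * (1 + ε₀) ^ 4 :=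
          mul_lt_mul_of_pos_right h1 (by positivity)
      _ = (1 + ε₀) ^ 5 := by ring
  -- the a-weighted energy of shell `n` is `θⁿ` times a shell-`0` energy
  have hkey : ∀ (n : ℕ) (σ : ℝ),
      physWeight a ε₀ ^ n * (Real.exp (2 * σ) * ‖W (n : ℤ) σ‖ ^ 2) ≤ θ ^ n * P' := by
    intro n σ
    rw [horbit n σ]
    have e1 : Real.exp (2 * σ) = Real.exp (2 * T) ^ n * Real.exp (2 * (σ - n * T)) := by
      rw [← Real.exp_nat_mul, ← Real.exp_add]; congr 1; ring
    rw [e1]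
    calc physWeight a ε₀ ^ n * (Real.exp (2 * T) ^ n * Real.exp (2 * (σ - n * T)) * ‖W 0 (σ - n * T)‖ ^ 2)
        = θ ^ n * (Real.exp (2 * (σ - n * T)) * ‖W 0 (σ - n * T)‖ ^ 2) := by rw [hθ, mul_pow]; ring
      _ ≤ θ ^ n * P' := mul_le_mul_of_nonneg_left (hE0 _) (pow_nonneg hθ0 n)
  -- no level survives
  rintro ⟨c, hc, H⟩
  have ht : Tendsto (fun n : ℕ => θ ^ n * P') atTop (𝓝 (0 * P')) :=
    (tendsto_pow_atTop_nhds_zero_of_lt_one hθ0 hθ1).mul_const P'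
  rw [zero_mul] at ht
  obtain ⟨N, hN⟩ := (ht.eventually (gt_mem_nhds hc)).exists_forall_of_atTop
  obtain ⟨n, hn, σ, -, hle⟩ := H N
  have h1 := hkey n σ
  have h2 : θ ^ n * P' < c := hN n hn
  linarith

/-- **The surviving loud pumps are EXACTLY critical**: at every fine scale the witness of `survivingLoudPump_at_scale` is
(S₁)-surviving and NOT (S_a)-surviving for any `a < 1`.  MODEL lattice only.
[cite: Tao2016AveragedNS, §4 Thm. 4.2 (statement shape), the viscous equation before it, §6.4; cell vocabulary (stmt-NavierStokesRegularity-20419)] -/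
theorem survivingLoudPump_at_scale_critical (ε₀ : ℝ) (hε₀ : 0 < ε₀)
    (hε₀le : (1 + ε₀) ^ ((5 : ℝ) / 2) ≤ 3 / 2) :
    ∃ R : ℝ, 1 ≤ R ∧ ∃ α : Fin 4 → Fin 4 → Fin 4 → ℤ × ℤ × ℤ → ℝ, InTableClass R α ∧
      ∃ W : ℤ → ℝ → Em 4, IsEternalVisc ε₀ 1 α W ∧ UniformBound W ∧ EternalSurvivingFwd 1 ε₀ W ∧
        ∀ a : ℝ, a < 1 → ¬ EternalSurvivingFwd a ε₀ W := by
  obtain ⟨R, hR, α, hα, W, hW, hU, hS, hD, -, -⟩ := survivingLoudPump_at_scale ε₀ hε₀ hε₀le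
  exact ⟨R, hR, α, hα, W, hW, hU, hS, fun a ha => not_survivingFwd_of_blockDSS_lt_one hε₀ hU (hW.bdd 0) hD ha⟩

end Summit.NavierStokesRegularity.NavierStokesRegularity.Theorems.NoSurvivingEternalViscBddOne.SurvivingPumps

end
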